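import Literature.NumberTheory.GaloisRepresentations.AbsGaloisInvolutionsUnique

/-!
# Automorphisms of `Gal(K̄/K)` permute the real places of `K`

Sequel to `AbsGaloisInvolutions.lean` (existence: involutions are complex conjugations,
Artin–Schreier) and `AbsGaloisInvolutionsUnique.lean` (uniqueness: a complex conjugation
determines its real place, `IsComplexConjugationAt.place_unique`).  For a field `K` and
`Gal(K̄/K) = Field.absoluteGaloisGroup K`:

* `IsComplexConjugation.of_isConj` — being a complex conjugation for `φ` is a property of the
  CONJUGACY CLASS of `c` (converse of `IsComplexConjugation.isConj`); hence
  `IsComplexConjugationAt.isConj_iff_eq`: two complex conjugations are conjugate in `Gal(K̄/K)` iff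
  they sit at the same real place — the real places of `K` are in bijection with the conjugacy
  classes of complex conjugations.
* `exists_realPlacePerm_of_mulEquiv` / `realPlacePerm_unique` — for `K` algebraic over `ℚ` (e.g. a
  number field) every group automorphism `α` of `Gal(K̄/K)` (no continuity needed) induces a UNIQUE
  permutation `e` of the real places of `K` with
  `IsComplexConjugationAt hw c → IsComplexConjugationAt (e w) (α c)`; it is functorial
  (`realPlacePerm_trans`, `realPlacePerm_symm`) and trivial on inner automorphisms
  (`realPlacePerm_eq_refl_of_inner`), so it only depends on the outer class of `α`.  This is the
  archimedean clause of Neukirch–Uchida-type rigidity («`α` permutes the decomposition groups of the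
  archimedean primes»), unconditional; number-field / continuous forms
  `existsUnique_realPlacePerm_of_continuousMulEquiv`, `NumberField.existsUnique_realPlacePerm`.

Proof-only file: no definitions, instances or notation.  Classical; abc-iut cell bookkeeping for
GAP-LEDGER row G-L4d2g4-1 (archimedean clause, «ARCH-EQUIVARIANT-PERM»); nothing here concerns
the disputed [IUTchIII] Cor. 3.12.

References: E. Artin, O. Schreier, *Eine Kennzeichnung der reell abgeschlossenen Körper* (1927),
Satz 4 (bib `ArtinSchreier1927Kennzeichnung`); S. Lang, *Algebra* (bib `Lang2002`), XI §2
Thm. 2.2 / Thm. 2.9 (uniqueness of the ordering of a real closed field / of real closures);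
J. Neukirch, *Algebraic Number Theory* (bib `NeukirchANT1999`), Ch. I §9 (decomposition groups of
conjugate primes are conjugate);
Neukirch–Schmidt–Wingberg, *Cohomology of Number Fields* (bib `NeukirchSchmidtWingberg2008`),
XII §2 (context: Neukirch–Uchida).
-/

noncomputable section

namespace Literature.NumberTheory.GaloisRepresentations

open NumberField Field

section ConjugacyClass

variable {K : Type*} [Field K] {φ : K →+* ℝ} {c c' : absoluteGaloisGroup K}

/-- Being a complex conjugation for `φ` is a class function: if `c` is one and `c'` is conjugate
to `c` in `Gal(K̄/K)`, so is `c'` (replace the embedding `ι` by `ι ∘ g⁻¹`).  Converse direction of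
`IsComplexConjugation.isConj`.  Archimedean analogue of «the decomposition group of the conjugate
prime `σ𝔓` is `σ G_𝔓 σ⁻¹`». [cite: NeukirchANT1999, Ch. I §9 p. 54 (after (9.1): G_{σ𝔓} = σ G_𝔓 σ⁻¹)] -/
theorem IsComplexConjugation.of_isConj (hc : IsComplexConjugation φ c) (h : IsConj c c') :
    IsComplexConjugation φ c' := by
  obtain ⟨g, rfl⟩ := isConj_iff.mp h
  obtain ⟨ι, hιφ, hι⟩ := isComplexConjugation_iff.mp hc
  refine isComplexConjugation_iff.mpr
    ⟨ι.comp (MulSemiringAction.toRingHom (absoluteGaloisGroup K) (AlgebraicClosure K) g⁻¹),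
      ?_, fun y => ?_⟩
  · rw [RingHom.comp_assoc, ← hιφ]
    congr 1
    ext1 k
    rw [RingHom.comp_apply, MulSemiringAction.toRingHom_apply, absoluteGaloisGroup.smul_def,
      AlgEquiv.commutes]
  · simp only [RingHom.comp_apply, MulSemiringAction.toRingHom_apply]
    rw [← mul_smul, ← mul_assoc, ← mul_assoc, inv_mul_cancel, one_mul, mul_smul, hι]

/-- Place form of `IsComplexConjugation.of_isConj`.
[cite: NeukirchANT1999, Ch. I §9 p. 54 (after (9.1): G_{σ𝔓} = σ G_𝔓 σ⁻¹; archimedean analogue)] -/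
theorem IsComplexConjugationAt.of_isConj {w : InfinitePlace K} {hw : w.IsReal}
    (hc : IsComplexConjugationAt hw c) (h : IsConj c c') : IsComplexConjugationAt hw c' :=
  IsComplexConjugation.of_isConj hc h

/-- **Real places ↔ conjugacy classes of complex conjugations**: two complex conjugations of
`Gal(K̄/K)` are conjugate iff they sit at the same real place (⇒: `of_isConj` and
`IsComplexConjugationAt.place_unique`; ⇐: `IsComplexConjugation.isConj`).
[cite: Lang2002, XI §2 Thm. 2.2 (uniqueness of the ordering of the real closed field K̄^c)]
[cite: NeukirchANT1999, Ch. I §9 p. 54 (after (9.1): G_{σ𝔓} = σ G_𝔓 σ⁻¹; archimedean analogue)] -/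
theorem IsComplexConjugationAt.isConj_iff_eq {w w' : InfinitePlace K} {hw : w.IsReal}
    {hw' : w'.IsReal} (hc : IsComplexConjugationAt hw c) (hc' : IsComplexConjugationAt hw' c') :
    IsConj c c' ↔ w = w' := by
  refine ⟨fun h => (hc.of_isConj h).place_unique hc', ?_⟩
  rintro rfl
  exact IsComplexConjugation.isConj hc hc'

end ConjugacyClass

section Permutation

variable {K : Type*} [Field K] [CharZero K] [Algebra.IsAlgebraic ℚ K]

/-- For `K` algebraic over `ℚ` and a group automorphism `α` of `Gal(K̄/K)`, there is a map `f` on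
the real places of `K` such that `α` carries every complex conjugation at `w` to a complex
conjugation at `f w`.  (Existence of `f w` for ONE conjugation at `w`:
`exists_isComplexConjugationAt_map_of_mulEquiv` (Artin–Schreier); independence of the choice:
the conjugations at `w` form one conjugacy class, `IsComplexConjugation.isConj` / `of_isConj`.)
[cite: ArtinSchreier1927Kennzeichnung, Satz 4 (corollary for automorphisms of Galois groups)] -/
theorem exists_realPlaceMap_of_mulEquiv (α : absoluteGaloisGroup K ≃* absoluteGaloisGroup K) :
    ∃ f : {w : InfinitePlace K // w.IsReal} → {w : InfinitePlace K // w.IsReal},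
      ∀ (w : {w : InfinitePlace K // w.IsReal}) (c : absoluteGaloisGroup K),
        IsComplexConjugationAt w.2 c → IsComplexConjugationAt (f w).2 (α c) := by
  -- a reference conjugation at each real place
  have href : ∀ w : {w : InfinitePlace K // w.IsReal}, ∃ c : absoluteGaloisGroup K,
      IsComplexConjugationAt w.2 c := fun w =>
    exists_isComplexConjugation (InfinitePlace.embedding_of_isReal w.2)
  choose c₀ hc₀ using href
  have himg : ∀ w : {w : InfinitePlace K // w.IsReal}, ∃ w' : {w : InfinitePlace K // w.IsReal},
      IsComplexConjugationAt w'.2 (α (c₀ w)) := fun w => by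
    obtain ⟨w', hw', h⟩ := exists_isComplexConjugationAt_map_of_mulEquiv α w.2 (hc₀ w)
    exact ⟨⟨w', hw'⟩, h⟩
  choose f hf using himg
  refine ⟨f, fun w c hc => ?_⟩
  exact (hf w).of_isConj (α.toMonoidHom.map_isConj (IsComplexConjugation.isConj (hc₀ w) hc))

omit [CharZero K] [Algebra.IsAlgebraic ℚ K] in
/-- Uniqueness of the map of `exists_realPlaceMap_of_mulEquiv`: a map `f` on real places with
`IsComplexConjugationAt hw c → IsComplexConjugationAt (f w) (α c)` is determined by `α` (every
real place carries a complex conjugation, `exists_isComplexConjugation`, and the real place of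
`α c` is unique, `IsComplexConjugationAt.place_unique`).
[cite: Lang2002, XI §2 Thm. 2.2 (uniqueness of the ordering of a real closed field)] -/
theorem realPlaceMap_unique (α : absoluteGaloisGroup K ≃* absoluteGaloisGroup K)
    {f g : {w : InfinitePlace K // w.IsReal} → {w : InfinitePlace K // w.IsReal}}
    (hf : ∀ (w : {w : InfinitePlace K // w.IsReal}) (c : absoluteGaloisGroup K),
      IsComplexConjugationAt w.2 c → IsComplexConjugationAt (f w).2 (α c))
    (hg : ∀ (w : {w : InfinitePlace K // w.IsReal}) (c : absoluteGaloisGroup K),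
      IsComplexConjugationAt w.2 c → IsComplexConjugationAt (g w).2 (α c)) :
    f = g := by
  funext w
  obtain ⟨c, hc⟩ := exists_isComplexConjugation (InfinitePlace.embedding_of_isReal w.2)
  exact Subtype.ext ((hf w c hc).place_unique (hg w c hc))

/-- **Automorphisms of `Gal(K̄/K)` permute the real places.**  For `K` algebraic over `ℚ` (e.g. a
number field) and any group automorphism `α` of `Gal(K̄/K)` there is a permutation `e` of the real
places of `K` such that `α` carries the complex conjugations at `w` to complex conjugations at
`e w` (and `α⁻¹` those at `e w` back to `w`).  This is the archimedean clause of Neukirch-type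
rigidity («`α` permutes the decomposition groups `{1, c}` of the archimedean primes»),
unconditional; `e` is unique (`realPlacePerm_unique`).
[cite: ArtinSchreier1927Kennzeichnung, Satz 4 (corollary for automorphisms of Galois groups)];
context [cite: NeukirchSchmidtWingberg2008, XII §2 (12.2.1) Neukirch–Uchida]. -/
theorem exists_realPlacePerm_of_mulEquiv (α : absoluteGaloisGroup K ≃* absoluteGaloisGroup K) :
    ∃ e : {w : InfinitePlace K // w.IsReal} ≃ {w : InfinitePlace K // w.IsReal},
      ∀ (w : {w : InfinitePlace K // w.IsReal}) (c : absoluteGaloisGroup K),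
        IsComplexConjugationAt w.2 c → IsComplexConjugationAt (e w).2 (α c) := by
  obtain ⟨f, hf⟩ := exists_realPlaceMap_of_mulEquiv α
  obtain ⟨g, hg⟩ := exists_realPlaceMap_of_mulEquiv α.symm
  have hgf : ∀ w, g (f w) = w := fun w => by
    obtain ⟨c, hc⟩ := exists_isComplexConjugation (InfinitePlace.embedding_of_isReal w.2)
    have h := hg (f w) (α c) (hf w c hc)
    rw [MulEquiv.symm_apply_apply] at h
    exact Subtype.ext (h.place_unique hc)
  have hfg : ∀ w, f (g w) = w := fun w => by
    obtain ⟨c, hc⟩ := exists_isComplexConjugation (InfinitePlace.embedding_of_isReal w.2)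
    have h := hf (g w) (α.symm c) (hg w c hc)
    rw [MulEquiv.apply_symm_apply] at h
    exact Subtype.ext (h.place_unique hc)
  exact ⟨⟨f, g, hgf, hfg⟩, hf⟩

omit [CharZero K] [Algebra.IsAlgebraic ℚ K] in
/-- Uniqueness of the permutation of `exists_realPlacePerm_of_mulEquiv`.
[cite: Lang2002, XI §2 Thm. 2.2 (uniqueness of the ordering of a real closed field)] -/
theorem realPlacePerm_unique (α : absoluteGaloisGroup K ≃* absoluteGaloisGroup K)
    {e e' : {w : InfinitePlace K // w.IsReal} ≃ {w : InfinitePlace K // w.IsReal}}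
    (he : ∀ (w : {w : InfinitePlace K // w.IsReal}) (c : absoluteGaloisGroup K),
      IsComplexConjugationAt w.2 c → IsComplexConjugationAt (e w).2 (α c))
    (he' : ∀ (w : {w : InfinitePlace K // w.IsReal}) (c : absoluteGaloisGroup K),
      IsComplexConjugationAt w.2 c → IsComplexConjugationAt (e' w).2 (α c)) :
    e = e' :=
  Equiv.ext fun w => congrFun (realPlaceMap_unique α he he') w

omit [CharZero K] [Algebra.IsAlgebraic ℚ K] in
/-- Functoriality (composition): if `e` is compatible with `α` and `e'` with `β` (in the sense of
`exists_realPlacePerm_of_mulEquiv`), then `e.trans e'` is compatible with `α.trans β`; with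
`realPlacePerm_unique`, the permutation of `α.trans β` is `(e α).trans (e β)`.  (Bookkeeping
corollary of the uniqueness of the real place of a complex conjugation.)
[cite: Lang2002, XI §2 Thm. 2.2 (uniqueness of the ordering of a real closed field; corollary)] -/
theorem realPlacePerm_trans {α β : absoluteGaloisGroup K ≃* absoluteGaloisGroup K}
    {e e' : {w : InfinitePlace K // w.IsReal} ≃ {w : InfinitePlace K // w.IsReal}}
    (he : ∀ (w : {w : InfinitePlace K // w.IsReal}) (c : absoluteGaloisGroup K),
      IsComplexConjugationAt w.2 c → IsComplexConjugationAt (e w).2 (α c))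
    (he' : ∀ (w : {w : InfinitePlace K // w.IsReal}) (c : absoluteGaloisGroup K),
      IsComplexConjugationAt w.2 c → IsComplexConjugationAt (e' w).2 (β c))
    (w : {w : InfinitePlace K // w.IsReal}) (c : absoluteGaloisGroup K)
    (hc : IsComplexConjugationAt w.2 c) :
    IsComplexConjugationAt ((e.trans e') w).2 ((α.trans β) c) := by
  rw [Equiv.trans_apply, MulEquiv.trans_apply]
  exact he' (e w) (α c) (he w c hc)

/-- Functoriality (inverse): if `e` is compatible with `α`, then `e.symm` is compatible with
`α.symm`; with `realPlacePerm_unique`, the permutation of `α.symm` is `(e α).symm`.  (Uses the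
existence half of Artin–Schreier once more: `α.symm c` is a complex conjugation at SOME real place
`w'`, and `α (α.symm c) = c` pins `e w' = w`.)
[cite: ArtinSchreier1927Kennzeichnung, Satz 4 (corollary for automorphisms of Galois groups)] -/
theorem realPlacePerm_symm {α : absoluteGaloisGroup K ≃* absoluteGaloisGroup K}
    {e : {w : InfinitePlace K // w.IsReal} ≃ {w : InfinitePlace K // w.IsReal}}
    (he : ∀ (w : {w : InfinitePlace K // w.IsReal}) (c : absoluteGaloisGroup K),
      IsComplexConjugationAt w.2 c → IsComplexConjugationAt (e w).2 (α c))
    (w : {w : InfinitePlace K // w.IsReal}) (c : absoluteGaloisGroup K)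
    (hc : IsComplexConjugationAt w.2 c) :
    IsComplexConjugationAt (e.symm w).2 (α.symm c) := by
  obtain ⟨w', hw', h'⟩ := exists_isComplexConjugationAt_map_of_mulEquiv α.symm w.2 hc
  have h := he ⟨w', hw'⟩ (α.symm c) h'
  rw [MulEquiv.apply_symm_apply] at h
  have hw : e ⟨w', hw'⟩ = w := Subtype.ext (h.place_unique hc)
  rw [← hw, Equiv.symm_apply_apply]
  exact h'

omit [CharZero K] [Algebra.IsAlgebraic ℚ K] in
/-- Inner automorphisms act trivially on the real places: if `α` is conjugation by some
`g ∈ Gal(K̄/K)`, the compatible permutation is the identity (so the permutation of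
`exists_realPlacePerm_of_mulEquiv` only depends on the OUTER class of `α`).  Archimedean
analogue of `G_{σ𝔓} = σ G_𝔓 σ⁻¹`.
[cite: NeukirchANT1999, Ch. I §9 p. 54 (after (9.1): G_{σ𝔓} = σ G_𝔓 σ⁻¹; archimedean analogue)] -/
theorem realPlacePerm_eq_refl_of_inner (g : absoluteGaloisGroup K)
    {e : {w : InfinitePlace K // w.IsReal} ≃ {w : InfinitePlace K // w.IsReal}}
    (he : ∀ (w : {w : InfinitePlace K // w.IsReal}) (c : absoluteGaloisGroup K),
      IsComplexConjugationAt w.2 c → IsComplexConjugationAt (e w).2 (MulAut.conj g c)) :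
    e = Equiv.refl _ := by
  refine realPlacePerm_unique (MulAut.conj g) he fun w c hc => ?_
  rw [MulAut.conj_apply]
  exact hc.of_isConj (isConj_iff.mpr ⟨g, rfl⟩)

/-- Continuous form of `exists_realPlacePerm_of_mulEquiv` (the shape `α : G_K ≃ₜ* G_K` used by the
anabelian consumers), with uniqueness built in.
[cite: ArtinSchreier1927Kennzeichnung, Satz 4 (corollary for automorphisms of Galois groups)] -/
theorem existsUnique_realPlacePerm_of_continuousMulEquiv
    (α : absoluteGaloisGroup K ≃ₜ* absoluteGaloisGroup K) :
    ∃! e : {w : InfinitePlace K // w.IsReal} ≃ {w : InfinitePlace K // w.IsReal},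
      ∀ (w : {w : InfinitePlace K // w.IsReal}) (c : absoluteGaloisGroup K),
        IsComplexConjugationAt w.2 c → IsComplexConjugationAt (e w).2 (α c) := by
  obtain ⟨e, he⟩ := exists_realPlacePerm_of_mulEquiv α.toMulEquiv
  exact ⟨e, he, fun e' he' => realPlacePerm_unique α.toMulEquiv he' he⟩

/-- Number-field instance, in the shape of abc-iut GAP-LEDGER row G-L4d2g4-1 (archimedean
clause, with uniqueness of the target place): a continuous automorphism `α` of `G_F` induces a
unique permutation of the real places of `F` compatible with complex conjugations.
[cite: ArtinSchreier1927Kennzeichnung, Satz 4 (corollary for automorphisms of Galois groups)];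
context [cite: NeukirchSchmidtWingberg2008, XII §2 (12.2.1)]. -/
theorem NumberField.existsUnique_realPlacePerm (F : Type*) [Field F] [NumberField F]
    (α : absoluteGaloisGroup F ≃ₜ* absoluteGaloisGroup F) :
    ∃! e : {w : InfinitePlace F // w.IsReal} ≃ {w : InfinitePlace F // w.IsReal},
      ∀ (w : {w : InfinitePlace F // w.IsReal}) (c : absoluteGaloisGroup F),
        IsComplexConjugationAt w.2 c → IsComplexConjugationAt (e w).2 (α c) :=
  existsUnique_realPlacePerm_of_continuousMulEquiv α

end Permutation

end Literature.NumberTheory.GaloisRepresentations
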